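import Summits.CriticalPhenomena.PercolationContinuityZ3.Theorems.PercNearOneGluingNoHeavyLowerTailSunflowerNestedSheetPencilCertificate
import HarnessLib

/-!
# `NoHeavyLowerTail` (crux stmt-CriticalPhenomena-4575), abstract sunflower cubic at LAW level: (C1) ON NESTED DOUBLY-SHEETED PENCILS —
# an infinite six-parameter family of laws (every structure `[z=0: PC*(G); z=1: PC(W)]` with `G_i ⊆ W_i` on disjoint blocks), containing the K₄ case

Support file (seat `prim-ineq-gen-2` gen 32; `--supports stmt-CriticalPhenomena-4575`).  Nothing is asserted about the crux; no `sorry`, no named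
facts, no definitions, standard axioms.  Memo: run/shared/lean/prim/prim-ineq-gen-2/CUBIC-SIGN-LAW-GEN32.md §2b (THEOREM 4).

THE FAMILY.  Three disjoint blocks of coins; on block `i` a configuration is in `G_i` (mass `g_i ≥ 0`), in `W_i ∖ G_i` (`u_i ≥ 0`) or outside `W_i`
(`v_i ≥ 0`) — up-sets `G_i ⊆ W_i`; we keep everything HOMOGENEOUS (no normalisation `g_i+u_i+v_i = 1` is needed).  The structure `θ(ω,z)` is
`PC*(G₁,G₂,G₃)` (core = all three `G_i`, petal `k` = exactly `G_i,G_j`) for `z = 0` and `PC(W₁,W₂,W₃)` (bottom = no `W_i`, petal `k` = only `W_k`,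
core = at least two) for `z = 1`; it is monotone since `PC* ≤ PC` pointwise and `G_i ⊆ W_i`.  Its law at bias `t` of `z` is the pencil
`m_t = (1−t)·m* + t·m_P` of the `PC*(g)` cells `(b*, c*_k, a*)` (`as, bs, cs_k` below) and the `PC(w)` cells `(b_P, c_P,k, a_P)` (`ap, bp, cp_k`),
`w = g + u`.  The merged `K₄` three-colourings (`…FourPointSixPetal`, gen 32 §2) are the face `u = 0`.

THEOREM (`nestedPencil_C1`): **(C1) `e₃(c) ≤ max(a,b)·(ab − e₂(c))` holds at every `m_t`, `t ∈ [0,1]`, for all `g,u,v ≥ 0`.**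
CERTIFICATE (explicit polynomials with positive coefficients in `g,u,v`; found by computer algebra, checked here by `ring`/`positivity`):
with `β = ⟨m_P, ∇LA(m*)⟩`, `M = ⟨m*, ∇LA(m_P)⟩`, `u₀ = a_P − b_P`, `w₀ = b* − a*`, `X = a*·(total − a_P)`, `AG_P = a_Pb_P − e₂(c_P)`:
 `β = −w₀·X + P₀` (`nested_beta_eq`, 188 terms), `M = T + u₀·X − w₀·AG_P` (`nested_T_eq`, 827 terms),
 `LA(m_t) = t·Λ(t)`, `Λ(t) = β + (M − 2β)t + (β − M + u₀AG_P)t²` (`nested_LA_eq`; uses `LA(m*) = 0`, `LA(m_P) = u₀·AG_P`),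
 leading coefficient `β − M + u₀AG_P = −D₁D₂D₃ ≤ 0` with `D_k = μ_P(E_k) − μ*(E_k) ≥ 0` explicit (`nested_L3_eq`; the cubic sign law),
 `Λ(0) = β ≥ 0` when `a* ≥ b*`, `Λ(1) = u₀·AG_P ≥ 0` when `a_P ≥ b_P` (`AG_P = w₁w₂w₃v₁v₂v₃`), and at the crossing `t* = w₀/(u₀+w₀)`:
 `(u₀+w₀)²Λ(t*) = u₀·(u₀P₀ + w₀T) ≥ 0`.  Concavity (`concave_quad_between`) finishes the A-side; the B-side is the A-side
 of the dual parameters `(g,u,v,t) ↦ (v,u,g,1−t)` (`nested_LB_nonneg`).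
-/

namespace Summit.CriticalPhenomena.PercolationContinuityZ3.Theorems.SunflowerPartition

namespace NestedSheetPencil

/-- A concave quadratic (`L₃ ≤ 0`) that is nonnegative at `x ≤ y` is nonnegative at every `z ∈ [x, y]`. [folklore] -/
theorem concave_quad_between {L₁ L₂ L₃ x y z : ℝ} (hL₃ : L₃ ≤ 0) (hxz : x ≤ z) (hzy : z ≤ y)
    (hx : 0 ≤ L₁ + L₂ * x + L₃ * x ^ 2) (hy : 0 ≤ L₁ + L₂ * y + L₃ * y ^ 2) :
    0 ≤ L₁ + L₂ * z + L₃ * z ^ 2 := by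
  have key : (y - x) ^ 2 * (L₁ + L₂ * z + L₃ * z ^ 2) =
      (y - z) * (y - x) * (L₁ + L₂ * x + L₃ * x ^ 2) + (z - x) * (y - x) * (L₁ + L₂ * y + L₃ * y ^ 2) +
        (-L₃) * ((z - x) * (y - z) * (y - x) ^ 2) := by
    ring
  rcases eq_or_lt_of_le (hxz.trans hzy) with hxy | hxy
  · have hzx : z = x := le_antisymm (hxy ▸ hzy) hxz
    rw [hzx]; exact hx
  · have h1 : 0 ≤ (y - z) * (y - x) * (L₁ + L₂ * x + L₃ * x ^ 2) := mul_nonneg (mul_nonneg (by linarith) (by linarith)) hx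
    have h2 : 0 ≤ (z - x) * (y - x) * (L₁ + L₂ * y + L₃ * y ^ 2) := mul_nonneg (mul_nonneg (by linarith) (by linarith)) hy
    have h3 : 0 ≤ (-L₃) * ((z - x) * (y - z) * (y - x) ^ 2) :=
      mul_nonneg (by linarith) (mul_nonneg (mul_nonneg (by linarith) (by linarith)) (sq_nonneg _))
    have hpos : 0 < (y - x) ^ 2 := by positivity
    by_contra hneg
    push Not at hneg
    have h4 : (y - x) ^ 2 * (L₁ + L₂ * z + L₃ * z ^ 2) < 0 := mul_neg_of_pos_of_neg hpos hneg
    linarith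

section Pencil

variable {g₁ g₂ g₃ u₁ u₂ u₃ v₁ v₂ v₃ t a b c₁ c₂ c₃ as bs cs₁ cs₂ cs₃ ap bp cp₁ cp₂ cp₃ : ℝ}

/-- Cubic expansion of `LA` along the pencil (pure algebra in the cells): `LA(m_t) = (1−t)³LA(m*) + (1−t)²t·β + (1−t)t²·M + t³·LA(m_P)`. [this work] -/
theorem nested_LA_expand
    (hb : b = (1-t)*bs + t*bp) (hc₁ : c₁ = (1-t)*cs₁ + t*cp₁) (hc₂ : c₂ = (1-t)*cs₂ + t*cp₂) (hc₃ : c₃ = (1-t)*cs₃ + t*cp₃)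
    (ha : a = (1-t)*as + t*ap) :
    a*(a*b - (c₁*c₂+c₁*c₃+c₂*c₃)) - c₁*c₂*c₃ =
      (1-t)^3 * (as*(as*bs - (cs₁*cs₂+cs₁*cs₃+cs₂*cs₃)) - cs₁*cs₂*cs₃)
      + (1-t)^2*t * (ap*(2*as*bs - (cs₁*cs₂+cs₁*cs₃+cs₂*cs₃)) + bp*as^2 - cp₁*(as*(cs₂+cs₃)+cs₂*cs₃) - cp₂*(as*(cs₁+cs₃)+cs₁*cs₃) - cp₃*(as*(cs₁+cs₂)+cs₁*cs₂))
      + (1-t)*t^2 * (as*(2*ap*bp - (cp₁*cp₂+cp₁*cp₃+cp₂*cp₃)) + bs*ap^2 - cs₁*(ap*(cp₂+cp₃)+cp₂*cp₃) - cs₂*(ap*(cp₁+cp₃)+cp₁*cp₃) - cs₃*(ap*(cp₁+cp₂)+cp₁*cp₂))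
      + t^3 * (ap*(ap*bp - (cp₁*cp₂+cp₁*cp₃+cp₂*cp₃)) - cp₁*cp₂*cp₃) := by
  rw [ha, hb, hc₁, hc₂, hc₃]; ring

/-- `LA(m*) = 0`: the `PC*` law is on the A-sheet (as homogeneous forms). [this work] -/
theorem nested_LA_star (has : as = g₁*g₂*g₃) (hcs₁ : cs₁ = g₂*g₃*(u₁+v₁)) (hcs₂ : cs₂ = g₁*g₃*(u₂+v₂)) (hcs₃ : cs₃ = g₁*g₂*(u₃+v₃))
    (hbs : bs = (g₁+u₁+v₁)*(g₂+u₂+v₂)*(g₃+u₃+v₃) - g₁*g₂*g₃ - g₂*g₃*(u₁+v₁) - g₁*g₃*(u₂+v₂) - g₁*g₂*(u₃+v₃))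
    (_hbp : bp = v₁*v₂*v₃) (_hcp₁ : cp₁ = (g₁+u₁)*v₂*v₃) (_hcp₂ : cp₂ = (g₂+u₂)*v₁*v₃) (_hcp₃ : cp₃ = (g₃+u₃)*v₁*v₂)
    (_hap : ap = (g₁+u₁+v₁)*(g₂+u₂+v₂)*(g₃+u₃+v₃) - v₁*v₂*v₃ - (g₁+u₁)*v₂*v₃ - (g₂+u₂)*v₁*v₃ - (g₃+u₃)*v₁*v₂) :
    as*(as*bs - (cs₁*cs₂+cs₁*cs₃+cs₂*cs₃)) - cs₁*cs₂*cs₃ = 0 := by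
  rw [has, hbs, hcs₁, hcs₂, hcs₃]; ring

/-- `AG(m_P) = w₁w₂w₃·v₁v₂v₃`. [this work] -/
theorem nested_AG_pc (_has : as = g₁*g₂*g₃) (_hcs₁ : cs₁ = g₂*g₃*(u₁+v₁)) (_hcs₂ : cs₂ = g₁*g₃*(u₂+v₂)) (_hcs₃ : cs₃ = g₁*g₂*(u₃+v₃))
    (_hbs : bs = (g₁+u₁+v₁)*(g₂+u₂+v₂)*(g₃+u₃+v₃) - g₁*g₂*g₃ - g₂*g₃*(u₁+v₁) - g₁*g₃*(u₂+v₂) - g₁*g₂*(u₃+v₃))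
    (hbp : bp = v₁*v₂*v₃) (hcp₁ : cp₁ = (g₁+u₁)*v₂*v₃) (hcp₂ : cp₂ = (g₂+u₂)*v₁*v₃) (hcp₃ : cp₃ = (g₃+u₃)*v₁*v₂)
    (hap : ap = (g₁+u₁+v₁)*(g₂+u₂+v₂)*(g₃+u₃+v₃) - v₁*v₂*v₃ - (g₁+u₁)*v₂*v₃ - (g₂+u₂)*v₁*v₃ - (g₃+u₃)*v₁*v₂) :
    (ap*bp - (cp₁*cp₂+cp₁*cp₃+cp₂*cp₃)) = (g₁+u₁)*(g₂+u₂)*(g₃+u₃)*(v₁*v₂*v₃) := by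
  rw [hap, hbp, hcp₁, hcp₂, hcp₃]; ring

/-- `LA(m_P) = (a_P − b_P)·AG(m_P)`: the `PC` law is on the B-sheet. [this work] -/
theorem nested_LA_pc (_has : as = g₁*g₂*g₃) (_hcs₁ : cs₁ = g₂*g₃*(u₁+v₁)) (_hcs₂ : cs₂ = g₁*g₃*(u₂+v₂)) (_hcs₃ : cs₃ = g₁*g₂*(u₃+v₃))
    (_hbs : bs = (g₁+u₁+v₁)*(g₂+u₂+v₂)*(g₃+u₃+v₃) - g₁*g₂*g₃ - g₂*g₃*(u₁+v₁) - g₁*g₃*(u₂+v₂) - g₁*g₂*(u₃+v₃))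
    (hbp : bp = v₁*v₂*v₃) (hcp₁ : cp₁ = (g₁+u₁)*v₂*v₃) (hcp₂ : cp₂ = (g₂+u₂)*v₁*v₃) (hcp₃ : cp₃ = (g₃+u₃)*v₁*v₂)
    (hap : ap = (g₁+u₁+v₁)*(g₂+u₂+v₂)*(g₃+u₃+v₃) - v₁*v₂*v₃ - (g₁+u₁)*v₂*v₃ - (g₂+u₂)*v₁*v₃ - (g₃+u₃)*v₁*v₂) :
    ap*(ap*bp - (cp₁*cp₂+cp₁*cp₃+cp₂*cp₃)) - cp₁*cp₂*cp₃ = (ap - bp) * (ap*bp - (cp₁*cp₂+cp₁*cp₃+cp₂*cp₃)) := by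
  rw [hap, hbp, hcp₁, hcp₂, hcp₃]; ring

/-- **(β) first-order exit from the A-sheet**: `β = ⟨m_P, ∇LA(m*)⟩ = (a* − b*)·a*·(total − a_P) + P₀` with `P₀ ≥ 0` (the sum of the
`nested_P0_chunk` pieces: 188 monomials with positive coefficients in `g,u,v`). [this work] -/
theorem nested_beta_eq (hg₁ : 0 ≤ g₁) (hg₂ : 0 ≤ g₂) (hg₃ : 0 ≤ g₃) (hu₁ : 0 ≤ u₁) (hu₂ : 0 ≤ u₂) (hu₃ : 0 ≤ u₃)
    (hv₁ : 0 ≤ v₁) (hv₂ : 0 ≤ v₂) (hv₃ : 0 ≤ v₃)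
    (has : as = g₁*g₂*g₃) (hcs₁ : cs₁ = g₂*g₃*(u₁+v₁)) (hcs₂ : cs₂ = g₁*g₃*(u₂+v₂)) (hcs₃ : cs₃ = g₁*g₂*(u₃+v₃))
    (hbs : bs = (g₁+u₁+v₁)*(g₂+u₂+v₂)*(g₃+u₃+v₃) - g₁*g₂*g₃ - g₂*g₃*(u₁+v₁) - g₁*g₃*(u₂+v₂) - g₁*g₂*(u₃+v₃))
    (hbp : bp = v₁*v₂*v₃) (hcp₁ : cp₁ = (g₁+u₁)*v₂*v₃) (hcp₂ : cp₂ = (g₂+u₂)*v₁*v₃) (hcp₃ : cp₃ = (g₃+u₃)*v₁*v₂)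
    (hap : ap = (g₁+u₁+v₁)*(g₂+u₂+v₂)*(g₃+u₃+v₃) - v₁*v₂*v₃ - (g₁+u₁)*v₂*v₃ - (g₂+u₂)*v₁*v₃ - (g₃+u₃)*v₁*v₂) :
    ∃ P₀ : ℝ, 0 ≤ P₀ ∧ ap*(2*as*bs - (cs₁*cs₂+cs₁*cs₃+cs₂*cs₃)) + bp*as^2 - cp₁*(as*(cs₂+cs₃)+cs₂*cs₃) - cp₂*(as*(cs₁+cs₃)+cs₁*cs₃) - cp₃*(as*(cs₁+cs₂)+cs₁*cs₂) = (as - bs) * (as * ((g₁+u₁+v₁)*(g₂+u₂+v₂)*(g₃+u₃+v₃) - ap)) + P₀ := by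
  obtain ⟨r1, hr1, er1⟩ := nested_P0_chunk1 hg₁ hg₂ hg₃ hu₁ hu₂ hu₃ hv₁ hv₂ hv₃
  obtain ⟨r2, hr2, er2⟩ := nested_P0_chunk2 hg₁ hg₂ hg₃ hu₁ hu₂ hu₃ hv₁ hv₂ hv₃
  obtain ⟨r3, hr3, er3⟩ := nested_P0_chunk3 hg₁ hg₂ hg₃ hu₁ hu₂ hu₃ hv₁ hv₂ hv₃
  obtain ⟨r4, hr4, er4⟩ := nested_P0_chunk4 hg₁ hg₂ hg₃ hu₁ hu₂ hu₃ hv₁ hv₂ hv₃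
  obtain ⟨r5, hr5, er5⟩ := nested_P0_chunk5 hg₁ hg₂ hg₃ hu₁ hu₂ hu₃ hv₁ hv₂ hv₃
  refine ⟨r1 + r2 + r3 + r4 + r5, by positivity, ?_⟩
  rw [er1, er2, er3, er4, er5, has, hbs, hcs₁, hcs₂, hcs₃, hap, hbp, hcp₁, hcp₂, hcp₃]; ring

/-- **(T) the crossing certificate**: `M = ⟨m*, ∇LA(m_P)⟩ = T + (a_P − b_P)·a*·(total − a_P) − (b* − a*)·AG(m_P)` with `T ≥ 0` (the sum of
the `nested_T_chunk` pieces: 827 monomials with positive coefficients in `g,u,v`). [this work] -/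
theorem nested_T_eq (hg₁ : 0 ≤ g₁) (hg₂ : 0 ≤ g₂) (hg₃ : 0 ≤ g₃) (hu₁ : 0 ≤ u₁) (hu₂ : 0 ≤ u₂) (hu₃ : 0 ≤ u₃)
    (hv₁ : 0 ≤ v₁) (hv₂ : 0 ≤ v₂) (hv₃ : 0 ≤ v₃)
    (has : as = g₁*g₂*g₃) (hcs₁ : cs₁ = g₂*g₃*(u₁+v₁)) (hcs₂ : cs₂ = g₁*g₃*(u₂+v₂)) (hcs₃ : cs₃ = g₁*g₂*(u₃+v₃))
    (hbs : bs = (g₁+u₁+v₁)*(g₂+u₂+v₂)*(g₃+u₃+v₃) - g₁*g₂*g₃ - g₂*g₃*(u₁+v₁) - g₁*g₃*(u₂+v₂) - g₁*g₂*(u₃+v₃))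
    (hbp : bp = v₁*v₂*v₃) (hcp₁ : cp₁ = (g₁+u₁)*v₂*v₃) (hcp₂ : cp₂ = (g₂+u₂)*v₁*v₃) (hcp₃ : cp₃ = (g₃+u₃)*v₁*v₂)
    (hap : ap = (g₁+u₁+v₁)*(g₂+u₂+v₂)*(g₃+u₃+v₃) - v₁*v₂*v₃ - (g₁+u₁)*v₂*v₃ - (g₂+u₂)*v₁*v₃ - (g₃+u₃)*v₁*v₂) :
    ∃ T : ℝ, 0 ≤ T ∧ as*(2*ap*bp - (cp₁*cp₂+cp₁*cp₃+cp₂*cp₃)) + bs*ap^2 - cs₁*(ap*(cp₂+cp₃)+cp₂*cp₃) - cs₂*(ap*(cp₁+cp₃)+cp₁*cp₃) - cs₃*(ap*(cp₁+cp₂)+cp₁*cp₂) = T + (ap - bp) * (as * ((g₁+u₁+v₁)*(g₂+u₂+v₂)*(g₃+u₃+v₃) - ap)) - (bs - as) * (ap*bp - (cp₁*cp₂+cp₁*cp₃+cp₂*cp₃)) := by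
  obtain ⟨q1, hq1, eq1⟩ := nested_T_chunk1 hg₁ hg₂ hg₃ hu₁ hu₂ hu₃ hv₁ hv₂ hv₃
  obtain ⟨q2, hq2, eq2⟩ := nested_T_chunk2 hg₁ hg₂ hg₃ hu₁ hu₂ hu₃ hv₁ hv₂ hv₃
  obtain ⟨q3, hq3, eq3⟩ := nested_T_chunk3 hg₁ hg₂ hg₃ hu₁ hu₂ hu₃ hv₁ hv₂ hv₃
  obtain ⟨q4, hq4, eq4⟩ := nested_T_chunk4 hg₁ hg₂ hg₃ hu₁ hu₂ hu₃ hv₁ hv₂ hv₃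
  obtain ⟨q5, hq5, eq5⟩ := nested_T_chunk5 hg₁ hg₂ hg₃ hu₁ hu₂ hu₃ hv₁ hv₂ hv₃
  obtain ⟨q6, hq6, eq6⟩ := nested_T_chunk6 hg₁ hg₂ hg₃ hu₁ hu₂ hu₃ hv₁ hv₂ hv₃
  obtain ⟨q7, hq7, eq7⟩ := nested_T_chunk7 hg₁ hg₂ hg₃ hu₁ hu₂ hu₃ hv₁ hv₂ hv₃
  obtain ⟨q8, hq8, eq8⟩ := nested_T_chunk8 hg₁ hg₂ hg₃ hu₁ hu₂ hu₃ hv₁ hv₂ hv₃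
  obtain ⟨q9, hq9, eq9⟩ := nested_T_chunk9 hg₁ hg₂ hg₃ hu₁ hu₂ hu₃ hv₁ hv₂ hv₃
  obtain ⟨q10, hq10, eq10⟩ := nested_T_chunk10 hg₁ hg₂ hg₃ hu₁ hu₂ hu₃ hv₁ hv₂ hv₃
  obtain ⟨q11, hq11, eq11⟩ := nested_T_chunk11 hg₁ hg₂ hg₃ hu₁ hu₂ hu₃ hv₁ hv₂ hv₃
  obtain ⟨q12, hq12, eq12⟩ := nested_T_chunk12 hg₁ hg₂ hg₃ hu₁ hu₂ hu₃ hv₁ hv₂ hv₃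
  obtain ⟨q13, hq13, eq13⟩ := nested_T_chunk13 hg₁ hg₂ hg₃ hu₁ hu₂ hu₃ hv₁ hv₂ hv₃
  obtain ⟨q14, hq14, eq14⟩ := nested_T_chunk14 hg₁ hg₂ hg₃ hu₁ hu₂ hu₃ hv₁ hv₂ hv₃
  obtain ⟨q15, hq15, eq15⟩ := nested_T_chunk15 hg₁ hg₂ hg₃ hu₁ hu₂ hu₃ hv₁ hv₂ hv₃
  obtain ⟨q16, hq16, eq16⟩ := nested_T_chunk16 hg₁ hg₂ hg₃ hu₁ hu₂ hu₃ hv₁ hv₂ hv₃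
  obtain ⟨q17, hq17, eq17⟩ := nested_T_chunk17 hg₁ hg₂ hg₃ hu₁ hu₂ hu₃ hv₁ hv₂ hv₃
  obtain ⟨q18, hq18, eq18⟩ := nested_T_chunk18 hg₁ hg₂ hg₃ hu₁ hu₂ hu₃ hv₁ hv₂ hv₃
  obtain ⟨q19, hq19, eq19⟩ := nested_T_chunk19 hg₁ hg₂ hg₃ hu₁ hu₂ hu₃ hv₁ hv₂ hv₃
  obtain ⟨q20, hq20, eq20⟩ := nested_T_chunk20 hg₁ hg₂ hg₃ hu₁ hu₂ hu₃ hv₁ hv₂ hv₃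
  obtain ⟨q21, hq21, eq21⟩ := nested_T_chunk21 hg₁ hg₂ hg₃ hu₁ hu₂ hu₃ hv₁ hv₂ hv₃
  refine ⟨q1 + q2 + q3 + q4 + q5 + q6 + q7 + q8 + q9 + q10 + q11 + q12 + q13 + q14 + q15 + q16 + q17 + q18 + q19 + q20 + q21, by positivity, ?_⟩
  rw [eq1, eq2, eq3, eq4, eq5, eq6, eq7, eq8, eq9, eq10, eq11, eq12, eq13, eq14, eq15, eq16, eq17, eq18, eq19, eq20, eq21, has, hbs, hcs₁, hcs₂, hcs₃, hap, hbp, hcp₁, hcp₂, hcp₃]; ring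

/-- **Cubic sign law on the pencil**: the leading coefficient `β − M + (a_P − b_P)AG(m_P) = LA(m_P − m*) = −D₁D₂D₃ ≤ 0` with
`D_k = μ_P(E_k) − μ*(E_k) ≥ 0` (explicit polynomials with positive coefficients). [this work] -/
theorem nested_L3_eq (hg₁ : 0 ≤ g₁) (hg₂ : 0 ≤ g₂) (hg₃ : 0 ≤ g₃) (hu₁ : 0 ≤ u₁) (hu₂ : 0 ≤ u₂) (hu₃ : 0 ≤ u₃)
    (hv₁ : 0 ≤ v₁) (hv₂ : 0 ≤ v₂) (hv₃ : 0 ≤ v₃)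
    (has : as = g₁*g₂*g₃) (hcs₁ : cs₁ = g₂*g₃*(u₁+v₁)) (hcs₂ : cs₂ = g₁*g₃*(u₂+v₂)) (hcs₃ : cs₃ = g₁*g₂*(u₃+v₃))
    (hbs : bs = (g₁+u₁+v₁)*(g₂+u₂+v₂)*(g₃+u₃+v₃) - g₁*g₂*g₃ - g₂*g₃*(u₁+v₁) - g₁*g₃*(u₂+v₂) - g₁*g₂*(u₃+v₃))
    (hbp : bp = v₁*v₂*v₃) (hcp₁ : cp₁ = (g₁+u₁)*v₂*v₃) (hcp₂ : cp₂ = (g₂+u₂)*v₁*v₃) (hcp₃ : cp₃ = (g₃+u₃)*v₁*v₂)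
    (hap : ap = (g₁+u₁+v₁)*(g₂+u₂+v₂)*(g₃+u₃+v₃) - v₁*v₂*v₃ - (g₁+u₁)*v₂*v₃ - (g₂+u₂)*v₁*v₃ - (g₃+u₃)*v₁*v₂) :
    ∃ D : ℝ, 0 ≤ D ∧ (ap*(2*as*bs - (cs₁*cs₂+cs₁*cs₃+cs₂*cs₃)) + bp*as^2 - cp₁*(as*(cs₂+cs₃)+cs₂*cs₃) - cp₂*(as*(cs₁+cs₃)+cs₁*cs₃) - cp₃*(as*(cs₁+cs₂)+cs₁*cs₂)) - (as*(2*ap*bp - (cp₁*cp₂+cp₁*cp₃+cp₂*cp₃)) + bs*ap^2 - cs₁*(ap*(cp₂+cp₃)+cp₂*cp₃) - cs₂*(ap*(cp₁+cp₃)+cp₁*cp₃) - cs₃*(ap*(cp₁+cp₂)+cp₁*cp₂)) + (ap - bp) * (ap*bp - (cp₁*cp₂+cp₁*cp₃+cp₂*cp₃)) = -D := by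
  refine ⟨(g₁*g₂*u₃ + g₁*g₂*v₃ + g₁*g₃*u₂ + g₁*g₃*v₂ + g₁*u₂*u₃ + g₁*u₂*v₃ + g₁*u₃*v₂ + g₁*v₂*v₃ + g₂*u₁*u₃ + g₂*u₁*v₃ + g₂*u₃*v₁ + g₃*u₁*u₂ + g₃*u₁*v₂ + g₃*u₂*v₁ + u₁*u₂*u₃ + u₁*u₂*v₃ + u₁*u₃*v₂ + u₁*v₂*v₃ + u₂*u₃*v₁) * (g₁*g₂*u₃ + g₁*g₂*v₃ + g₁*u₂*u₃ + g₁*u₂*v₃ + g₁*u₃*v₂ + g₂*g₃*u₁ + g₂*g₃*v₁ + g₂*u₁*u₃ + g₂*u₁*v₃ + g₂*u₃*v₁ + g₂*v₁*v₃ + g₃*u₁*u₂ + g₃*u₁*v₂ + g₃*u₂*v₁ + u₁*u₂*u₃ + u₁*u₂*v₃ + u₁*u₃*v₂ + u₂*u₃*v₁ + u₂*v₁*v₃) * (g₁*g₃*u₂ + g₁*g₃*v₂ + g₁*u₂*u₃ + g₁*u₂*v₃ + g₁*u₃*v₂ + g₂*g₃*u₁ + g₂*g₃*v₁ + g₂*u₁*u₃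 + g₂*u₁*v₃ + g₂*u₃*v₁ + g₃*u₁*u₂ + g₃*u₁*v₂ + g₃*u₂*v₁ + g₃*v₁*v₂ + u₁*u₂*u₃ + u₁*u₂*v₃ + u₁*u₃*v₂ + u₂*u₃*v₁ + u₃*v₁*v₂), by positivity, ?_⟩
  rw [has, hbs, hcs₁, hcs₂, hcs₃, hap, hbp, hcp₁, hcp₂, hcp₃]; ring

set_option maxHeartbeats 400000 in
/-- **(C1), A-side, on the nested doubly-sheeted pencil**: `a ≥ b ⟹ e₃(c) ≤ a·(ab − e₂(c))`. [this work] -/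
theorem nested_LA_nonneg (hg₁ : 0 ≤ g₁) (hg₂ : 0 ≤ g₂) (hg₃ : 0 ≤ g₃) (hu₁ : 0 ≤ u₁) (hu₂ : 0 ≤ u₂) (hu₃ : 0 ≤ u₃)
    (hv₁ : 0 ≤ v₁) (hv₂ : 0 ≤ v₂) (hv₃ : 0 ≤ v₃) (ht : 0 ≤ t) (ht' : t ≤ 1)
    (has : as = g₁*g₂*g₃) (hcs₁ : cs₁ = g₂*g₃*(u₁+v₁)) (hcs₂ : cs₂ = g₁*g₃*(u₂+v₂)) (hcs₃ : cs₃ = g₁*g₂*(u₃+v₃))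
    (hbs : bs = (g₁+u₁+v₁)*(g₂+u₂+v₂)*(g₃+u₃+v₃) - g₁*g₂*g₃ - g₂*g₃*(u₁+v₁) - g₁*g₃*(u₂+v₂) - g₁*g₂*(u₃+v₃))
    (hbp : bp = v₁*v₂*v₃) (hcp₁ : cp₁ = (g₁+u₁)*v₂*v₃) (hcp₂ : cp₂ = (g₂+u₂)*v₁*v₃) (hcp₃ : cp₃ = (g₃+u₃)*v₁*v₂)
    (hap : ap = (g₁+u₁+v₁)*(g₂+u₂+v₂)*(g₃+u₃+v₃) - v₁*v₂*v₃ - (g₁+u₁)*v₂*v₃ - (g₂+u₂)*v₁*v₃ - (g₃+u₃)*v₁*v₂)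
    (hb : b = (1-t)*bs + t*bp) (hc₁ : c₁ = (1-t)*cs₁ + t*cp₁) (hc₂ : c₂ = (1-t)*cs₂ + t*cp₂) (hc₃ : c₃ = (1-t)*cs₃ + t*cp₃)
    (ha : a = (1-t)*as + t*ap) (hab : b ≤ a) :
    c₁*c₂*c₃ ≤ a*(a*b - (c₁*c₂+c₁*c₃+c₂*c₃)) := by
  -- abstract names and the certificate pieces
  obtain ⟨β, hβ⟩ : ∃ x : ℝ, x = ap*(2*as*bs - (cs₁*cs₂+cs₁*cs₃+cs₂*cs₃)) + bp*as^2 - cp₁*(as*(cs₂+cs₃)+cs₂*cs₃) - cp₂*(as*(cs₁+cs₃)+cs₁*cs₃) - cp₃*(as*(cs₁+cs₂)+cs₁*cs₂) := ⟨_, rfl⟩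
  obtain ⟨M, hM⟩ : ∃ x : ℝ, x = as*(2*ap*bp - (cp₁*cp₂+cp₁*cp₃+cp₂*cp₃)) + bs*ap^2 - cs₁*(ap*(cp₂+cp₃)+cp₂*cp₃) - cs₂*(ap*(cp₁+cp₃)+cp₁*cp₃) - cs₃*(ap*(cp₁+cp₂)+cp₁*cp₂) := ⟨_, rfl⟩
  obtain ⟨AGp, hAGp⟩ : ∃ x : ℝ, x = (ap*bp - (cp₁*cp₂+cp₁*cp₃+cp₂*cp₃)) := ⟨_, rfl⟩
  obtain ⟨X, hX⟩ : ∃ x : ℝ, x = as * ((g₁+u₁+v₁)*(g₂+u₂+v₂)*(g₃+u₃+v₃) - ap) := ⟨_, rfl⟩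
  have hE := nested_LA_expand (as := as) (bs := bs) (cs₁ := cs₁) (cs₂ := cs₂) (cs₃ := cs₃) (ap := ap) (bp := bp) (cp₁ := cp₁)
    (cp₂ := cp₂) (cp₃ := cp₃) hb hc₁ hc₂ hc₃ ha
  have h0 := nested_LA_star has hcs₁ hcs₂ hcs₃ hbs hbp hcp₁ hcp₂ hcp₃ hap
  have hAG := nested_AG_pc has hcs₁ hcs₂ hcs₃ hbs hbp hcp₁ hcp₂ hcp₃ hap
  have h1 := nested_LA_pc has hcs₁ hcs₂ hcs₃ hbs hbp hcp₁ hcp₂ hcp₃ hap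
  obtain ⟨P₀, hP₀0, hF4⟩ := nested_beta_eq hg₁ hg₂ hg₃ hu₁ hu₂ hu₃ hv₁ hv₂ hv₃ has hcs₁ hcs₂ hcs₃ hbs hbp hcp₁ hcp₂ hcp₃ hap
  obtain ⟨T, hT0, hF5⟩ := nested_T_eq hg₁ hg₂ hg₃ hu₁ hu₂ hu₃ hv₁ hv₂ hv₃ has hcs₁ hcs₂ hcs₃ hbs hbp hcp₁ hcp₂ hcp₃ hap
  obtain ⟨D, hD0, hF3⟩ := nested_L3_eq hg₁ hg₂ hg₃ hu₁ hu₂ hu₃ hv₁ hv₂ hv₃ has hcs₁ hcs₂ hcs₃ hbs hbp hcp₁ hcp₂ hcp₃ hap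
  rw [← hβ] at hE hF4 hF3
  rw [← hM] at hE hF5 hF3
  rw [← hAGp] at h1 hF5 hF3 hAG hE
  rw [← hX] at hF4 hF5
  have hAGp0 : 0 ≤ AGp := by rw [hAG]; positivity
  have has0 : 0 ≤ as := by rw [has]; positivity
  have hX0 : 0 ≤ X := by
    rw [hX]
    have : (g₁+u₁+v₁)*(g₂+u₂+v₂)*(g₃+u₃+v₃) - ap = bp + cp₁ + cp₂ + cp₃ := by rw [hap, hbp, hcp₁, hcp₂, hcp₃]; ring
    rw [this, hbp, hcp₁, hcp₂, hcp₃]; positivity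
  clear hX hAG hβ hM hAGp
  -- a − b along the pencil: −w₀ + t·S₁ with w₀ = b* − a*, S₁ = u₀ + w₀, u₀ = a_P − b_P
  obtain ⟨w₀, hw₀⟩ : ∃ x : ℝ, x = bs - as := ⟨_, rfl⟩
  obtain ⟨u₀, hu₀⟩ : ∃ x : ℝ, x = ap - bp := ⟨_, rfl⟩
  have hab' : w₀ ≤ t * (u₀ + w₀) := by rw [hw₀, hu₀]; rw [ha, hb] at hab; linarith
  rw [← hu₀] at h1 hF5 hF3
  have hS : 0 ≤ u₀ + w₀ := by
    have e : u₀ + w₀ = g₁*g₂*u₃ + g₁*g₂*v₃ + g₁*g₃*u₂ + g₁*g₃*v₂ + 2*g₁*u₂*u₃ + 2*g₁*u₂*v₃ + 2*g₁*u₃*v₂ + g₁*v₂*v₃ + g₂*g₃*u₁ + g₂*g₃*v₁ + 2*g₂*u₁*u₃ + 2*g₂*u₁*v₃ + 2*g₂*u₃*v₁ + g₂*v₁*v₃ + 2*g₃*u₁*u₂ +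
        2*g₃*u₁*v₂ + 2*g₃*u₂*v₁ + g₃*v₁*v₂ + 2*u₁*u₂*u₃ + 2*u₁*u₂*v₃ + 2*u₁*u₃*v₂ + u₁*v₂*v₃ + 2*u₂*u₃*v₁ + u₂*v₁*v₃ + u₃*v₁*v₂ := by
      rw [hu₀, hw₀, hap, hbp, hbs, has]; ring
    rw [e]; positivity
  have hw₀' : as - bs = -w₀ := by rw [hw₀]; ring
  have hw₀'' : bs - as = w₀ := by rw [hw₀]
  rw [hw₀'] at hF4; rw [hw₀''] at hF5
  -- LA(m_t) = t·Λ(t) with Λ(t) = L₁ + L₂ t + L₃ t²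
  obtain ⟨L₃, hL₃⟩ : ∃ x : ℝ, x = β - M + u₀ * AGp := ⟨_, rfl⟩
  have hLA : a*(a*b - (c₁*c₂+c₁*c₃+c₂*c₃)) - c₁*c₂*c₃ = t * (β + (M - 2*β) * t + L₃ * t ^ 2) := by
    rw [hE, h0, h1, hL₃]; ring
  have hL₃0 : L₃ ≤ 0 := by
    rw [hL₃, hF3, neg_nonpos]; exact hD0
  rw [← sub_nonneg, hLA]
  clear hE h0 h1 hLA ha hb hc₁ hc₂ hc₃ has hbs hcs₁ hcs₂ hcs₃ hap hbp hcp₁ hcp₂ hcp₃ hab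
  have hu₀0 : 0 ≤ u₀ := by
    have hle : t * (u₀ + w₀) ≤ u₀ + w₀ := mul_le_of_le_one_left hS ht'
    linarith
  -- Λ(1) = u₀·AG_P ≥ 0
  have hΛ1 : 0 ≤ β + (M - 2*β) * 1 + L₃ * 1 ^ 2 := by
    have e : β + (M - 2*β) * 1 + L₃ * 1 ^ 2 = u₀ * AGp := by rw [hL₃]; ring
    rw [e]; exact mul_nonneg hu₀0 hAGp0
  suffices hΛ : 0 ≤ β + (M - 2*β) * t + L₃ * t ^ 2 from mul_nonneg ht hΛ
  by_cases hw0 : w₀ ≤ 0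
  · -- Case A: `a* ≥ b*`; Λ(0) = β ≥ 0; interpolate between 0 and 1
    have hΛ0 : 0 ≤ β + (M - 2*β) * 0 + L₃ * 0 ^ 2 := by
      have e : β + (M - 2*β) * 0 + L₃ * 0 ^ 2 = -w₀ * X + P₀ := by rw [hF4]; ring
      rw [e]; nlinarith [mul_nonneg (neg_nonneg.2 hw0) hX0]
    exact concave_quad_between hL₃0 ht ht' (by simpa using hΛ0) (by simpa using hΛ1)
  · -- Case C: interior crossing `t* = w₀/(u₀+w₀) ∈ (0, t]`
    push Not at hw0
    have hSpos : 0 < u₀ + w₀ := by linarith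
    obtain ⟨ts, hts⟩ : ∃ x : ℝ, x = w₀ / (u₀ + w₀) := ⟨_, rfl⟩
    have hts0 : 0 ≤ ts := by rw [hts]; exact div_nonneg hw0.le hSpos.le
    have htst : ts ≤ t := by rw [hts, div_le_iff₀ hSpos]; linarith
    have hts1 : ts ≤ 1 := htst.trans ht'
    have hΛts : 0 ≤ β + (M - 2*β) * ts + L₃ * ts ^ 2 := by
      have e : β + (M - 2*β) * ts + L₃ * ts ^ 2 =
          ((u₀ + w₀) ^ 2 * β + (u₀ + w₀) * (M - 2*β) * w₀ + L₃ * w₀ ^ 2) / (u₀ + w₀) ^ 2 := by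
        rw [hts]; field_simp
      have hc : (u₀ + w₀) ^ 2 * β + (u₀ + w₀) * (M - 2*β) * w₀ + L₃ * w₀ ^ 2 = u₀ * (u₀ * P₀ + w₀ * T) := by
        rw [hL₃, hF4, hF5]; ring
      rw [e, hc]
      apply div_nonneg _ (sq_nonneg _)
      exact mul_nonneg hu₀0 (by nlinarith [mul_nonneg hu₀0 hP₀0, mul_nonneg hw0.le hT0])
    exact concave_quad_between hL₃0 htst ht' hΛts (by simpa using hΛ1)

/-- **(C1), B-side**: `a ≤ b ⟹ e₃(c) ≤ b·(ab − e₂(c))` — the A-side for the dual parameters `(g,u,v,t) ↦ (v,u,g,1−t)` (complement duality swaps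
`PC*(G)` and `PC(W)`, core and bottom). [this work] -/
theorem nested_LB_nonneg (hg₁ : 0 ≤ g₁) (hg₂ : 0 ≤ g₂) (hg₃ : 0 ≤ g₃) (hu₁ : 0 ≤ u₁) (hu₂ : 0 ≤ u₂) (hu₃ : 0 ≤ u₃)
    (hv₁ : 0 ≤ v₁) (hv₂ : 0 ≤ v₂) (hv₃ : 0 ≤ v₃) (ht : 0 ≤ t) (ht' : t ≤ 1)
    (has : as = g₁*g₂*g₃) (hcs₁ : cs₁ = g₂*g₃*(u₁+v₁)) (hcs₂ : cs₂ = g₁*g₃*(u₂+v₂)) (hcs₃ : cs₃ = g₁*g₂*(u₃+v₃))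
    (hbs : bs = (g₁+u₁+v₁)*(g₂+u₂+v₂)*(g₃+u₃+v₃) - g₁*g₂*g₃ - g₂*g₃*(u₁+v₁) - g₁*g₃*(u₂+v₂) - g₁*g₂*(u₃+v₃))
    (hbp : bp = v₁*v₂*v₃) (hcp₁ : cp₁ = (g₁+u₁)*v₂*v₃) (hcp₂ : cp₂ = (g₂+u₂)*v₁*v₃) (hcp₃ : cp₃ = (g₃+u₃)*v₁*v₂)
    (hap : ap = (g₁+u₁+v₁)*(g₂+u₂+v₂)*(g₃+u₃+v₃) - v₁*v₂*v₃ - (g₁+u₁)*v₂*v₃ - (g₂+u₂)*v₁*v₃ - (g₃+u₃)*v₁*v₂)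
    (hb : b = (1-t)*bs + t*bp) (hc₁ : c₁ = (1-t)*cs₁ + t*cp₁) (hc₂ : c₂ = (1-t)*cs₂ + t*cp₂) (hc₃ : c₃ = (1-t)*cs₃ + t*cp₃)
    (ha : a = (1-t)*as + t*ap) (hba : a ≤ b) :
    c₁*c₂*c₃ ≤ b*(a*b - (c₁*c₂+c₁*c₃+c₂*c₃)) := by
  have h := nested_LA_nonneg (g₁ := v₁) (g₂ := v₂) (g₃ := v₃) (u₁ := u₁) (u₂ := u₂) (u₃ := u₃) (v₁ := g₁) (v₂ := g₂) (v₃ := g₃)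
    (t := 1 - t) (a := b) (b := a) (c₁ := c₁) (c₂ := c₂) (c₃ := c₃)
    (as := bp) (bs := ap) (cs₁ := cp₁) (cs₂ := cp₂) (cs₃ := cp₃) (ap := bs) (bp := as) (cp₁ := cs₁) (cp₂ := cs₂) (cp₃ := cs₃)
    hv₁ hv₂ hv₃ hu₁ hu₂ hu₃ hg₁ hg₂ hg₃ (by linarith) (by linarith)
    hbp (by rw [hcp₁]; ring) (by rw [hcp₂]; ring) (by rw [hcp₃]; ring) (by rw [hap]; ring)
    has (by rw [hcs₁]; ring) (by rw [hcs₂]; ring) (by rw [hcs₃]; ring) (by rw [hbs]; ring)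
    (by rw [ha]; ring) (by rw [hc₁]; ring) (by rw [hc₂]; ring) (by rw [hc₃]; ring) (by rw [hb]; ring) hba
  have e : b * (b * a - (c₁*c₂+c₁*c₃+c₂*c₃)) = b*(a*b - (c₁*c₂+c₁*c₃+c₂*c₃)) := by ring
  rw [e] at h; exact h

/-- **THEOREM ((C1) on every nested doubly-sheeted pencil).**  For `g,u,v ≥ 0` and `t ∈ [0,1]`, the law `m_t = (1−t)·PC*(g) + t·PC(g+u)`
satisfies `e₃(c) ≤ max(a,b)·(ab − e₂(c))`.  Hence (C1) for every sunflower `[z=0: PC*(G); z=1: PC(W)]`, `G_i ⊆ W_i` up-sets on disjoint blocks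
(any number of coins), at every product measure. [this work] -/
theorem nestedPencil_C1 (hg₁ : 0 ≤ g₁) (hg₂ : 0 ≤ g₂) (hg₃ : 0 ≤ g₃) (hu₁ : 0 ≤ u₁) (hu₂ : 0 ≤ u₂) (hu₃ : 0 ≤ u₃)
    (hv₁ : 0 ≤ v₁) (hv₂ : 0 ≤ v₂) (hv₃ : 0 ≤ v₃) (ht : 0 ≤ t) (ht' : t ≤ 1)
    (has : as = g₁*g₂*g₃) (hcs₁ : cs₁ = g₂*g₃*(u₁+v₁)) (hcs₂ : cs₂ = g₁*g₃*(u₂+v₂)) (hcs₃ : cs₃ = g₁*g₂*(u₃+v₃))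
    (hbs : bs = (g₁+u₁+v₁)*(g₂+u₂+v₂)*(g₃+u₃+v₃) - g₁*g₂*g₃ - g₂*g₃*(u₁+v₁) - g₁*g₃*(u₂+v₂) - g₁*g₂*(u₃+v₃))
    (hbp : bp = v₁*v₂*v₃) (hcp₁ : cp₁ = (g₁+u₁)*v₂*v₃) (hcp₂ : cp₂ = (g₂+u₂)*v₁*v₃) (hcp₃ : cp₃ = (g₃+u₃)*v₁*v₂)
    (hap : ap = (g₁+u₁+v₁)*(g₂+u₂+v₂)*(g₃+u₃+v₃) - v₁*v₂*v₃ - (g₁+u₁)*v₂*v₃ - (g₂+u₂)*v₁*v₃ - (g₃+u₃)*v₁*v₂)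
    (hb : b = (1-t)*bs + t*bp) (hc₁ : c₁ = (1-t)*cs₁ + t*cp₁) (hc₂ : c₂ = (1-t)*cs₂ + t*cp₂) (hc₃ : c₃ = (1-t)*cs₃ + t*cp₃)
    (ha : a = (1-t)*as + t*ap) :
    c₁*c₂*c₃ ≤ max a b * (a*b - (c₁*c₂+c₁*c₃+c₂*c₃)) := by
  rcases le_total b a with hab | hba
  · rw [max_eq_left hab]
    exact nested_LA_nonneg hg₁ hg₂ hg₃ hu₁ hu₂ hu₃ hv₁ hv₂ hv₃ ht ht' has hcs₁ hcs₂ hcs₃ hbs hbp hcp₁ hcp₂ hcp₃ hap hb hc₁ hc₂ hc₃ ha hab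
  · rw [max_eq_right hba]
    exact nested_LB_nonneg hg₁ hg₂ hg₃ hu₁ hu₂ hu₃ hv₁ hv₂ hv₃ ht ht' has hcs₁ hcs₂ hcs₃ hbs hbp hcp₁ hcp₂ hcp₃ hap hb hc₁ hc₂ hc₃ ha hba

end Pencil

end NestedSheetPencil

end Summit.CriticalPhenomena.PercolationContinuityZ3.Theorems.SunflowerPartition
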